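import Literature.MathematicalPhysics.QuantumFieldTheory.Balaban1983to89.B9Eq3105FamThreeLocCDiffOuterEntries
import Literature.MathematicalPhysics.QuantumFieldTheory.Balaban1983to89.B9Eq3105FamThreeLocCDiffAtoms
import Literature.MathematicalPhysics.QuantumFieldTheory.Balaban1983to89.B9Eq3105FamThreeLocCDiffSplit
import Literature.MathematicalPhysics.QuantumFieldTheory.Balaban1983to89.B9Cor36SiteSandwichTransferSrcGlobal

/-!
# `Balaban1983to89.B9Eq3105FamThreeLocCDiffCubeTails` — FAMILY 3 OF (3.105), THE `C`-DIFFERENCE WORD: THE CUBE TAILS ON THE MEMBER CARRIER — the suppliers of FILE 7's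
# displayed `hTail0∕1∕2 □ ν`, `hSbL □`, `hGw □ ν`, `hPb □` from cube-carrier majorants of `η²G′_□(Ṽ_□)` and `sQ′*_□X_□⁻¹Q′_□(Ṽ_□)` AT THE LOCALISED FIELD, the (3.33)
# rotation to `V′ = Ṽ_□^{u⁻¹}`, p38's sandwich transfers, and one scale transfer on each side to move the resolvent's weight `ℓ⁻⁴` onto the near source and back
# (sub-row G-B9-LETTERS, GAPS G-B9-05 family 3 (D2); programme FAMTHREE, F3-B3 FILE 8b)

statement-level skeleton of published theorems with citation tags; proofs where landed; nothing here is a claim about the Yang–Mills mass gap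

THE PRINTED LOCUS (held `paper:balaban1985-cmp99-background-propagators`, journal page = PDF page + 388).  p. 415 l. 26–37; Cor. 3.6 p. 408 (the cube sequence `{Ω′_j}`,
`□̃³ ⊂ Ω_j(□)`); (3.31)–(3.33) pp. 395–396 (gauge covariance); (3.42) p. 397; (3.48) p. 398; p. 409 l. 1–9 ((3.89) read in the member's blocks); p. 398 (remark after
(3.47): scale transfer); (3.19)–(3.21) pp. 393–394.  [4] = `Balaban1984PropagatorsII` (2.1)–(2.2) p. 224, (2.45)–(2.46) p. 231, (2.51) p. 232, Lemma 2.1 (2.60)–(2.61)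
p. 234.  [2] = `Balaban1983RegularityDecay` (1.11)–(1.12): statement type only.

THE POINT (bookkeeping; the one geometric fact used is r05's: a cube-sequence block lies inside a member block, with EQUAL (3.41) length near □).  A cube-carrier
majorant with the NEGATIVE weight `ℓ_□(a)⁻⁴` on global rows cannot be read on the member carrier row by row (far from □ the cube blocks are finer); but every
resolvent tail of FILE 5 has a NEAR source (the cut-off `𝟙[NearC 3S_j]`, `χ_□`, or the transition annulus of `K_χ`): one cube scale transfer puts the weight on the
source ([4] (2.60), symmetric reading — `hasMajorant_col_of_row`), p38's `hasMajorant_conj_site_sandwich` transfers a source-weighted kernel (near □ the lengths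
agree, member distances are shorter), and one member scale transfer puts the weight back on the row (`hasMajorant_row_of_col`).  Rows near □ (FILE 7's `hSbL`)
go through p38's source-global transfer directly; the positive-weight letter `η²G′_□(V′)` through its `_decay` form (`n = 2`, `m = 0`).

WHAT THIS FILE CERTIFIES (kernel-checked; 0 `def`, 0 `def … : Prop`, 0 sorry)

§1 `hasMajorant_row_of_col`, `hasMajorant_col_of_row` (any `B9.Geometry`); `len_cube_eq_len_member_of_nearH`, `blkOf_eq_of_blkCubeY_eq`,
   `smul_resolventWordCube_gauge_inv_eq` ((3.33) for `sS_□`).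
§2 ★★ `hasMajorant_conj_GpCube_member` (`conj((e·G′_□(V^{u⁻¹}))^ℝ) ≺ (M₂Σ)²B_fc₁·ℓ(a)²·e^{−(1−α_c)δ_Bd}` from the cube majorant at `V`);
   ★★ `hasMajorant_conj_cubeWord_mul_cut_member` (any cube word `W′ = R(u)⁻¹WR(u)` with `conj(W^ℝ) ≺ B_Sℓ_□⁻⁴e^{−δ_Sd_□}`, times a near cut-off `M_f`:
   `≺ ((M₂Σ)²B_SC_cC₄)·ℓ(a)⁻⁴·e^{−(δ_S − α_cδ_S − αδ₀)d}`); ★★ `hasMajorant_cut_mul_conj_cubeWord_member` (near rows: `≺ ((M₂Σ)²B_Sc₁)·ℓ(a)⁻⁴·e^{−(1−α_c)δ_Sd}`).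
§3 ★★★ `hasMajorant_tail0_at`, `hasMajorant_tail1_at`, `hasMajorant_tail2_at`, `hasMajorant_sbL_at`, `hasMajorant_projCube_member` — FILE 7's `hTail0∕1∕2 □ ν` (given the
   right entry's majorant, FILE 8a), `hSbL □`, `hPb □` (FILE 3 atoms + FILE 4 `hasMajorant_diag_coarsen`, at bi-contractive transporters of `V′`).
§4 ★★★ `hasMajorant_gw_at` — FILE 7's `hGw □ ν` by FILE 8a's `hasMajorant_mul_rightEntry_at`, modulo the displayed member majorant of the cube word
   `conj(sS_□(V′))·conj((G′_□K_χ)(V′)^ℝ)` (rows global, sources in the annulus; its supplier is the cube chain + §2, next file).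

HONEST SCOPE ∕ NOT CLAIMED.  Carrier-transfer bookkeeping over landed modules; displayed: the cube-carrier majorants AT `Ṽ_□` of `e·G′_□` (p33 `gp_cube_at_locCfg`'s
`GpVK`, up to the scalar's spelling) and of `sQ′*_□X_□⁻¹Q′_□` (p21 `cinv_cube_at_locCfg` + r05 `Q′_□` homs + FILE 3 A2), the cube and member scale transfers and
(2.61), the bi-contractive gauge `u` and transporters, FILE 8a's right entry, the `S_□G′_□K_χ` word; NO inequality of [B9] is proved here beyond them; NOT a node
discharge; nothing continuum ∕ OS ∕ mass-gap ∕ Clay; YM mass gap NOT proved (Track A conditional rung).  No `sorry`, no `axiom`, no `… : Prop` fact, no `instance`,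
no `notation`, no `def`.  NEW file; nothing landed is modified.  Cell `lit-balaban`, seat `lit-balaban-p33` gen 104, 2026-08-29; `--supports stmt-QuantumFields-19200`
as helper.  Net new unproved facts: 0.

RELATED IN THE TREE, NOT DUPLICATED (searched 2026-08-29: `rg 'row_of_col|cubeWord_mul_cut_member|tail0_at' Literature/` = ∅): p38 `B9Cor36SiteSandwichTransfer` ∕
`…SrcGlobal` (the transfers, USED BY NAME), F3-E2b `B9Eq3105FamThreeCommStepMember` (the same device for `R_χ`; `GpCubeY_gauge_inv_eq` BY NAME), FILES 3∕4∕8a of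
F3-B3 (atoms, `mul_decay_majorant_blk`, `hasMajorant_diag_coarsen`, `hasMajorant_mul_rightEntry_at` BY NAME), r05 `B9CubeCoarsening.blkOf_eq_of_cube_blkOf_eq`,
`B9CubeLettersOpsL0.levCubeY_eq_levY_of_nearH`.
-/

noncomputable section


namespace Literature.MathematicalPhysics.QuantumFieldTheory.Balaban1983to89.B9Eq3105FamThreeLocCDiffCubeTails

open NormedSpace Complex
open B6RandomWalk (HasMajorant hasMajorant_mono hasMajorant_add Ineq261 c1_nonneg Triangle254)
open B9Thm34Ext (toB6)
open B9Thm37Sum (mulOp mulOp_apply)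
open B9Ineq347 (ScaleTransfer)
open B9Eq352DivFormLetters (conj)
open B9Eq360DeltaPrimeACubeY (blkCubeY blkCubeY_apply)
open B6KLevelCensusIndexV1 (KIdx kGeo)
open B6Cover236MultiLevelBlocks (cubes)
open B6GlobalChartV1 (PV boxEquiv)
open B6Geom246MultiLevelBox (blkOf)
open B6Ineq2142KLevelV1 (β)
open B9GeoNormsKLevelV1 (geo9K)
open B9GeoLemma21KLevelV1 (geo9K_len_pos)
open B9CubeGeometryInputs (geoCK geoCK_len_pos geoCK_len_blkCubeY geoCK_dist_axioms)
open B9CubeLettersBondOpsL0 (QpCubeY QpsCubeY XinvCubeY BlkCubeY)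
open B9Eq39Adjoint (R)
open B9CubeLettersOpsL0 (GpCubeY levCubeY_eq_levY_of_nearH)
open B9CubeSequence408 (NearH)
open B9Thm37CubeCoverCommutators (cutMulY cutMulY_apply)
open B9Thm39CinvTorusRegular (conj_cutMulY)
open B9Eq310Hermitian (norm_R_le norm_R_inv_le)
open B9Cor36CubeCutoffs (SC NearC nearH_of_nearC)
open B9Cor36SiteSandwichTransfer (hasMajorant_conj_site_sandwich geo9K_len_site len_cube_le_len_member dist_member_le_dist_cube)
open B9Cor36SiteSandwichTransferSrcGlobal (hasMajorant_conj_site_sandwich_src_global hasMajorant_conj_site_sandwich_src_global_decay)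
open B9Eq3105FamTwoCore (geo9K_axioms)
open B9Eq3105FamThreeCommStepMember (GpCubeY_gauge_inv_eq)
open B9Eq3105FamThreeLocCDiffAtoms (resolventWordCube_gauge_inv_eq)
open B9Eq3105FamThreeLocCDiffChains (mul_decay_majorant_blk hasMajorant_diag_coarsen)
open Node00 (SiteY BlkY IBondY CfgY GaugeY toKT conjY gSiteY gaugeY parSymY etaS parSymY_isGaugeLawS)

variable {d ℓ : ℕ} {hd : 1 ≤ d + 1} {hL : Odd (ℓ + 1) ∧ 1 < ℓ + 1} {b₀ b₁ : ℝ}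
variable {𝔸 : Type} [NormedRing 𝔸] [NormedAlgebra ℂ 𝔸] [CompleteSpace 𝔸]
variable {ι : Type} [Fintype ι]
variable (i : KIdx d ℓ hd hL b₀ b₁) (c : ↥(cubes (toKT i).D.toDomains)) (b : Module.Basis ι ℝ 𝔸)

/-! ## §1  Row ↔ column weights by one scale transfer; the cube length near □ -/

section Weights

variable {X : Type} {g : B9.Geometry} [Fintype g.Site] {Rg : ℝ} {Hg : Prop}

/-- ★ column weight → row weight: `T ≺ κ·w(a′)·e^{−rd}` and `e^{−αδ₀d}w(a′) ≤ Cw(a)` ⟹ `T ≺ (κC)·w(a)·e^{−(r − αδ₀)d}`.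
[cite: Balaban1984PropagatorsII, Lemma 2.1 (2.60) p.234; Balaban1985BackgroundPropagators, p.398 (remark after (3.47))] -/
theorem hasMajorant_row_of_col (blk : X → g.Site) {T : Module.End ℝ (X → ℝ)} {κ r δ₀ α C : ℝ} (w : g.Site → ℝ) (hκ : 0 ≤ κ)
    (hST : ScaleTransfer g δ₀ α C w)
    (hT : HasMajorant (g := toB6 g Rg Hg) blk T (fun (a a' : g.Site) => κ * w a' * Real.exp (-(r * g.dist a a')))) :
    HasMajorant (g := toB6 g Rg Hg) blk T (fun (a a' : g.Site) => (κ * C) * w a * Real.exp (-((r - α * δ₀) * g.dist a a'))) := by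
  refine hasMajorant_mono (g := toB6 g Rg Hg) _ hT fun (a a' : g.Site) => ?_
  have h := hST a a'
  have he : Real.exp (-(r * g.dist a a')) = Real.exp (-(α * δ₀ * g.dist a a')) * Real.exp (-((r - α * δ₀) * g.dist a a')) := by
    rw [← Real.exp_add]; ring_nf
  calc κ * w a' * Real.exp (-(r * g.dist a a')) = κ * (Real.exp (-(α * δ₀ * g.dist a a')) * w a') * Real.exp (-((r - α * δ₀) * g.dist a a')) := by
        rw [he]; ring
    _ ≤ κ * (C * w a) * Real.exp (-((r - α * δ₀) * g.dist a a')) := mul_le_mul_of_nonneg_right (mul_le_mul_of_nonneg_left h hκ) (Real.exp_nonneg _)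
    _ = _ := by ring

/-- ★ row weight → column weight (the symmetric reading of the same transfer): `T ≺ κ·w(a)·e^{−rd}` ⟹ `T ≺ (κC)·w(a′)·e^{−(r − αδ₀)d}`.
[cite: Balaban1984PropagatorsII, Lemma 2.1 (2.60) p.234, (2.46) p.231 (symmetry of `d`)] -/
theorem hasMajorant_col_of_row (blk : X → g.Site) {T : Module.End ℝ (X → ℝ)} {κ r δ₀ α C : ℝ} (w : g.Site → ℝ) (hκ : 0 ≤ κ)
    (hsymm : ∀ a a' : g.Site, g.dist a a' = g.dist a' a) (hST : ScaleTransfer g δ₀ α C w)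
    (hT : HasMajorant (g := toB6 g Rg Hg) blk T (fun (a a' : g.Site) => κ * w a * Real.exp (-(r * g.dist a a')))) :
    HasMajorant (g := toB6 g Rg Hg) blk T (fun (a a' : g.Site) => (κ * C) * w a' * Real.exp (-((r - α * δ₀) * g.dist a a'))) := by
  refine hasMajorant_mono (g := toB6 g Rg Hg) _ hT fun (a a' : g.Site) => ?_
  have h := hST a' a
  rw [hsymm a' a] at h
  have he : Real.exp (-(r * g.dist a a')) = Real.exp (-(α * δ₀ * g.dist a a')) * Real.exp (-((r - α * δ₀) * g.dist a a')) := by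
    rw [← Real.exp_add]; ring_nf
  calc κ * w a * Real.exp (-(r * g.dist a a')) = κ * (Real.exp (-(α * δ₀ * g.dist a a')) * w a) * Real.exp (-((r - α * δ₀) * g.dist a a')) := by
        rw [he]; ring
    _ ≤ κ * (C * w a') * Real.exp (-((r - α * δ₀) * g.dist a a')) := mul_le_mul_of_nonneg_right (mul_le_mul_of_nonneg_left h hκ) (Real.exp_nonneg _)
    _ = _ := by ring

end Weights

section Geometry

/-- ★ near □ the cube sequence's block of a site has the member block's (3.41) length (`levCubeY = levY` on `NearH`).
[cite: Balaban1985BackgroundPropagators, p.408 (□̃³ ⊂ Ω_j(□)), (3.41) p.397; Balaban1984PropagatorsII, (2.1)–(2.2) p.224] -/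
theorem len_cube_eq_len_member_of_nearH (ιB : BlkY i → IBondY i) (hι : ∀ s, β i.hN i.D i.hk (ιB s) = s) {z : SiteY i} (hz : NearH c z.1) :
    (geoCK i c).len (blkCubeY i c z) = (geo9K i).len (ιB (blkOf i.D.toDomains z)) := by
  rw [(geoCK_len_blkCubeY i c z).1, levCubeY_eq_levY_of_nearH i c hz, geo9K_len_site i ιB hι z]

/-- two sites of one cube block share their member block. [cite: Balaban1985BackgroundPropagators, p.408; Balaban1984PropagatorsII, (2.45) p.231] -/
theorem blkOf_eq_of_blkCubeY_eq {z z' : SiteY i} (h : blkCubeY i c z' = blkCubeY i c z) : blkOf i.D.toDomains z' = blkOf i.D.toDomains z := by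
  have hz' := h
  rw [blkCubeY_apply, blkCubeY_apply] at hz'
  unfold B9CubeLettersOpsL0.cubeFamY at hz'
  exact B9CubeCoarsening.blkOf_eq_of_cube_blkOf_eq hz'

/-- (3.33) for the scaled cube resolvent word: `sS_□(V^{u⁻¹}) = R(u)⁻¹·(sS_□(V))·R(u)`. [cite: Balaban1985BackgroundPropagators, (3.31)–(3.33) pp.395–396, p.409 l.3–5] -/
theorem smul_resolventWordCube_gauge_inv_eq (σ : ℂ) (u : GaugeY 𝔸 i) (V : CfgY 𝔸 i) :
    (σ • (QpsCubeY i c (parSymY i) (gaugeY i u⁻¹ V) ∘ₗ XinvCubeY i c (parSymY i) (gaugeY i u⁻¹ V) ∘ₗ QpCubeY i c (parSymY i) (gaugeY i u⁻¹ V)) :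
        (SiteY i → 𝔸) →ₗ[ℂ] (SiteY i → 𝔸)) =
      conjY (gSiteY i u)⁻¹ * (σ • (QpsCubeY i c (parSymY i) V ∘ₗ XinvCubeY i c (parSymY i) V ∘ₗ QpCubeY i c (parSymY i) V)) * conjY (gSiteY i u) := by
  rw [resolventWordCube_gauge_inv_eq i c V u, mul_smul_comm, smul_mul_assoc]

end Geometry

/-! ## §2  The cube letters at `V′ = V^{u⁻¹}` on the member carrier: `η²G′_□(V′)` (rows and sources global), `sS_□(V′)·M_f` (sources near □), `M_f·sS_□(V′)` (rows near □) -/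

section Transfer

variable [Fintype (geo9K i).Site] {Rr : ℝ} {H : Prop} {Rr' : ℝ} {Hp : Prop}

set_option maxHeartbeats 1600000 in
/-- ★★ **`conj b((η²G′_□(V^{u⁻¹}))^ℝ)` ON THE MEMBER CARRIER** from its cube-carrier majorant at `V` (weight `ℓ_□²`, rows and sources global: p38's
`hasMajorant_conj_site_sandwich_src_global_decay` with `n = 2`, `m = 0`, after the (3.33) rotation `G′_□(V^{u⁻¹}) = R(u)⁻¹G′_□(V)R(u)`).
[cite: Balaban1985BackgroundPropagators, Cor. 3.6 p.408, (3.33) p.396, p.409 l.1–5, Thm 3.1 (3.42) p.397; Balaban1984PropagatorsII, (2.51) p.232, (2.46) p.231, Lemma 2.1 (2.61) p.234] -/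
theorem hasMajorant_conj_GpCube_member {M₂ : ℝ} (hM₂ : 0 ≤ M₂) (hrepr : ∀ (v : 𝔸) (j : ι), |b.repr v j| ≤ M₂ * ‖v‖)
    (u : GaugeY 𝔸 i) (hu : ∀ x, ‖((u x : 𝔸ˣ) : 𝔸)‖ ≤ 1 ∧ ‖(((u x)⁻¹ : 𝔸ˣ) : 𝔸)‖ ≤ 1) (V : CfgY 𝔸 i)
    (ιB : BlkY i → IBondY i) (hι : ∀ s, β i.hN i.D i.hk (ιB s) = s) (e : ℂ)
    (dBc : ℕ) {Bf δB αc : ℝ} (hBf : 0 ≤ Bf) (hδB : 0 ≤ δB) (hαc1 : αc ≤ 1) (h261c : Ineq261 dBc (toB6 (geoCK i c) Rr H) δB αc)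
    (hBc : HasMajorant (g := toB6 (geoCK i c) Rr H) (fun p : SiteY i × ι => blkCubeY i c p.1) (conj b ((e • GpCubeY i c (parSymY i) V).restrictScalars ℝ))
      (fun a s => Bf * (geoCK i c).len a ^ 2 * Real.exp (-(δB * (geoCK i c).dist a s)))) :
    HasMajorant (g := toB6 (geo9K i) Rr' Hp) (fun p : SiteY i × ι => ιB (blkOf i.D.toDomains p.1))
      (conj b ((e • GpCubeY i c (parSymY i) (gaugeY i u⁻¹ V)).restrictScalars ℝ))
      (fun a a' => (M₂ * ∑ j, ‖b j‖) ^ 2 * (Bf * B6.c1 dBc δB αc) * (geo9K i).len a ^ 2 * Real.exp (-((1 - αc) * δB * (geo9K i).dist a a'))) := by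
  have hγ : ∀ (z : SiteY i) (a : 𝔸), ‖R (gSiteY i u z) a‖ ≤ ‖a‖ ∧ ‖R (gSiteY i u z)⁻¹ a‖ ≤ ‖a‖ := fun z a =>
    ⟨norm_R_le (hu _).1 (hu _).2 a, norm_R_inv_le (hu _).1 (hu _).2 a⟩
  have hop : ((e • GpCubeY i c (parSymY i) (gaugeY i u⁻¹ V)).restrictScalars ℝ : Module.End ℝ (SiteY i → 𝔸)) =
      (cutMulY (𝔸 := 𝔸) (fun _ : SiteY i => (1 : ℝ))).restrictScalars ℝ ∘ₗ (conjY (gSiteY i u)⁻¹).restrictScalars ℝ ∘ₗ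
        ((e • GpCubeY i c (parSymY i) V).restrictScalars ℝ) ∘ₗ (conjY (gSiteY i u)).restrictScalars ℝ := by
    rw [GpCubeY_gauge_inv_eq i c (parSymY_isGaugeLawS i) u V]
    refine LinearMap.ext fun Λ => funext fun z => ?_
    simp only [LinearMap.restrictScalars_apply, LinearMap.smul_apply, LinearMap.coe_comp, Function.comp_apply, Module.End.mul_apply, map_smul,
      cutMulY_apply, Complex.ofReal_one, one_smul]
  rw [hop]
  refine hasMajorant_mono (g := toB6 (geo9K i) Rr' Hp) _
    (hasMajorant_conj_site_sandwich_src_global_decay i c b hM₂ hrepr (gSiteY i u) hγ (fun _ => (1 : ℝ)) zero_le_one (m := 0) (n := 2) (by norm_num)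
      (fun z => by simp) ιB hι Rr H Rr' Hp dBc hBf hδB hαc1 h261c _ hBc) fun a a' => le_of_eq ?_
  simp only [Nat.sub_zero]; ring

set_option maxHeartbeats 1600000 in
/-- ★★ **`conj b((sS_□(V^{u⁻¹}))^ℝ)·M_f♯` ON THE MEMBER CARRIER, SOURCES NEAR □** (`|f| ≤ 1`, `f ≠ 0 ⇒ NearC(3S_j)`): the cube-carrier majorant of the resolvent
word (weight `ℓ_□(a)⁻⁴` on the rows) is first read with the weight on the SOURCE (one cube scale transfer), transferred by p38's `hasMajorant_conj_site_sandwich`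
(near □ the cube block's length IS the member block's; member distances are shorter), then read back with the weight on the row (one member scale transfer):
`≺ ((M₂Σ‖b_j‖)²·B_SC_c·C₄)·ℓ(a)⁻⁴·e^{−(δ_S − α_cδ_S − αδ₀)d}`.
[cite: Balaban1985BackgroundPropagators, Cor. 3.6 p.408, (3.31)–(3.33) pp.395–396, Thm 3.2 (3.48) p.398, p.409 l.1–9, p.398 (remark after (3.47)); Balaban1984PropagatorsII, (2.51) p.232, (2.46) p.231, Lemma 2.1 (2.60) p.234] -/
theorem hasMajorant_conj_cubeWord_mul_cut_member {M₂ : ℝ} (hM₂ : 0 ≤ M₂) (hrepr : ∀ (v : 𝔸) (j : ι), |b.repr v j| ≤ M₂ * ‖v‖)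
    (u : GaugeY 𝔸 i) (hu : ∀ x, ‖((u x : 𝔸ˣ) : 𝔸)‖ ≤ 1 ∧ ‖(((u x)⁻¹ : 𝔸ˣ) : 𝔸)‖ ≤ 1)
    (ιB : BlkY i → IBondY i) (hι : ∀ s, β i.hN i.D i.hk (ιB s) = s) (W W' : (SiteY i → 𝔸) →ₗ[ℂ] (SiteY i → 𝔸))
    (hrot : W' = conjY (gSiteY i u)⁻¹ * W * conjY (gSiteY i u))
    (f : SiteY i → ℝ) (hf1 : ∀ z, |f z| ≤ 1) (hfnear : ∀ z, f z ≠ 0 → NearH c z.1)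
    {BS δS αc Cc : ℝ} (hBS : 0 ≤ BS) (hCc : 0 ≤ Cc) (hrc : 0 ≤ δS - αc * δS)
    (hSTc : ScaleTransfer (geoCK i c) δS αc Cc (fun a => ((geoCK i c).len a ^ 4)⁻¹))
    (hSc : HasMajorant (g := toB6 (geoCK i c) Rr H) (fun p : SiteY i × ι => blkCubeY i c p.1) (conj b (W.restrictScalars ℝ))
      (fun a s => BS * ((geoCK i c).len a ^ 4)⁻¹ * Real.exp (-(δS * (geoCK i c).dist a s))))
    {δ₀ α C4 : ℝ} (hST4 : ScaleTransfer (geo9K i) δ₀ α C4 (fun a => ((geo9K i).len a ^ 4)⁻¹)) :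
    HasMajorant (g := toB6 (geo9K i) Rr' Hp) (fun p : SiteY i × ι => ιB (blkOf i.D.toDomains p.1))
      (conj b (W'.restrictScalars ℝ) * mulOp (fun p : SiteY i × ι => f p.1))
      (fun a a' => ((M₂ * ∑ j, ‖b j‖) ^ 2 * (BS * Cc) * C4) * ((geo9K i).len a ^ 4)⁻¹ *
        Real.exp (-((δS - αc * δS - α * δ₀) * (geo9K i).dist a a'))) := by
  obtain ⟨hdnnC, -, -, hsymmC⟩ := geoCK_dist_axioms i c Rr H
  have hγ : ∀ (z : SiteY i) (a : 𝔸), ‖R (gSiteY i u z) a‖ ≤ ‖a‖ ∧ ‖R (gSiteY i u z)⁻¹ a‖ ≤ ‖a‖ := fun z a =>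
    ⟨norm_R_le (hu _).1 (hu _).2 a, norm_R_inv_le (hu _).1 (hu _).2 a⟩
  set M : Module.End ℝ (SiteY i → 𝔸) := W.restrictScalars ℝ with hM
  have hop : conj b (W'.restrictScalars ℝ) * mulOp (fun p : SiteY i × ι => f p.1) =
      conj b ((cutMulY (𝔸 := 𝔸) (fun _ : SiteY i => (1 : ℝ))).restrictScalars ℝ ∘ₗ (conjY (gSiteY i u)⁻¹).restrictScalars ℝ ∘ₗ M ∘ₗ
        (conjY (gSiteY i u)).restrictScalars ℝ ∘ₗ (cutMulY (𝔸 := 𝔸) f).restrictScalars ℝ) := by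
    rw [← conj_cutMulY b f, ← B9Eq352DivFormLetters.conj_mul, hrot, hM]
    refine congrArg (conj b) (LinearMap.ext fun Λ => funext fun z => ?_)
    simp only [LinearMap.restrictScalars_apply, LinearMap.coe_comp, Function.comp_apply, Module.End.mul_apply, cutMulY_apply, Complex.ofReal_one, one_smul]
  rw [hop]
  -- the cube majorant with the weight on the source
  have hSc' := hasMajorant_col_of_row (Rg := Rr) (Hg := H) (fun p : SiteY i × ι => blkCubeY i c p.1) (fun a => ((geoCK i c).len a ^ 4)⁻¹) hBS hsymmC hSTc hSc
  have hK0 : ∀ a a' : (geo9K i).Site, 0 ≤ (BS * Cc) * ((geo9K i).len a' ^ 4)⁻¹ * Real.exp (-((δS - αc * δS) * (geo9K i).dist a a')) := fun a a' => by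
    have := geo9K_len_pos i a'; positivity
  have hT := hasMajorant_conj_site_sandwich i c b hM₂ hrepr (gSiteY i u) hγ (fun _ => (1 : ℝ)) f (fun _ => (1 : ℝ)) (fun _ => (1 : ℝ))
    (fun z => by simp) hf1 hfnear ιB hι Rr H Rr' Hp
    (K := fun a a' => (BS * Cc) * ((geo9K i).len a' ^ 4)⁻¹ * Real.exp (-((δS - αc * δS) * (geo9K i).dist a a'))) hK0 (fun x x₀ hx₀ => ?_) M hSc'
  · have h2 := hasMajorant_row_of_col (Rg := Rr') (Hg := Hp) (fun p : SiteY i × ι => ιB (blkOf i.D.toDomains p.1)) (fun a => ((geo9K i).len a ^ 4)⁻¹)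
      (by positivity : 0 ≤ (M₂ * ∑ j, ‖b j‖) ^ 2 * (BS * Cc)) hST4
      (hasMajorant_mono (g := toB6 (geo9K i) Rr' Hp) _ hT fun a a' => le_of_eq (by ring))
    exact hasMajorant_mono (g := toB6 (geo9K i) Rr' Hp) _ h2 fun a a' => le_of_eq (by ring)
  · -- the comparison at an active (near) source `x₀`: equal lengths, shorter member distance
    have hlen := len_cube_eq_len_member_of_nearH i c ιB hι (hfnear x₀ hx₀)
    have hdD := dist_member_le_dist_cube i c ιB hι x x₀
    rw [one_mul, mul_one, hlen]
    have hl : 0 ≤ (BS * Cc) * ((geo9K i).len (ιB (blkOf i.D.toDomains x₀)) ^ 4)⁻¹ := by have := geo9K_len_pos i (ιB (blkOf i.D.toDomains x₀)); positivity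
    exact mul_le_mul_of_nonneg_left (Real.exp_le_exp.2 (neg_le_neg (mul_le_mul_of_nonneg_left hdD hrc))) hl

open Classical in
set_option maxHeartbeats 1600000 in
/-- ★★ **`M_f♯·conj b((sS_□(V^{u⁻¹}))^ℝ)` ON THE MEMBER CARRIER, ROWS NEAR □** (`|f| ≤ 1`, `f ≠ 0 ⇒ NearC(3S_j)`; sources global: p38's
`hasMajorant_conj_site_sandwich_src_global` with the cube (2.61); on an active row block the cube length is the member length):
`≺ ((M₂Σ‖b_j‖)²·B_S·c₁(dB_c, δ_S, α_c))·ℓ(a)⁻⁴·e^{−(1−α_c)δ_Sd}`.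
[cite: Balaban1985BackgroundPropagators, Cor. 3.6 p.408, (3.31)–(3.33) pp.395–396, Thm 3.2 (3.48) p.398, p.409 l.1–9; Balaban1984PropagatorsII, (2.51) p.232, (2.46) p.231, Lemma 2.1 (2.61) p.234] -/
theorem hasMajorant_cut_mul_conj_cubeWord_member {M₂ : ℝ} (hM₂ : 0 ≤ M₂) (hrepr : ∀ (v : 𝔸) (j : ι), |b.repr v j| ≤ M₂ * ‖v‖)
    (u : GaugeY 𝔸 i) (hu : ∀ x, ‖((u x : 𝔸ˣ) : 𝔸)‖ ≤ 1 ∧ ‖(((u x)⁻¹ : 𝔸ˣ) : 𝔸)‖ ≤ 1)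
    (ιB : BlkY i → IBondY i) (hι : ∀ s, β i.hN i.D i.hk (ιB s) = s) (W W' : (SiteY i → 𝔸) →ₗ[ℂ] (SiteY i → 𝔸))
    (hrot : W' = conjY (gSiteY i u)⁻¹ * W * conjY (gSiteY i u))
    (f : SiteY i → ℝ) (hf1 : ∀ z, |f z| ≤ 1) (hfnear : ∀ z, f z ≠ 0 → NearH c z.1)
    (dBc : ℕ) {BS δS αc : ℝ} (hBS : 0 ≤ BS) (hδS : 0 ≤ δS) (hαc1 : αc ≤ 1) (h261c : Ineq261 dBc (toB6 (geoCK i c) Rr H) δS αc)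
    (hSc : HasMajorant (g := toB6 (geoCK i c) Rr H) (fun p : SiteY i × ι => blkCubeY i c p.1) (conj b (W.restrictScalars ℝ))
      (fun a s => BS * ((geoCK i c).len a ^ 4)⁻¹ * Real.exp (-(δS * (geoCK i c).dist a s)))) :
    HasMajorant (g := toB6 (geo9K i) Rr' Hp) (fun p : SiteY i × ι => ιB (blkOf i.D.toDomains p.1))
      (mulOp (fun p : SiteY i × ι => f p.1) * conj b (W'.restrictScalars ℝ))
      (fun a a' => ((M₂ * ∑ j, ‖b j‖) ^ 2 * (BS * B6.c1 dBc δS αc)) * ((geo9K i).len a ^ 4)⁻¹ *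
        Real.exp (-((1 - αc) * δS * (geo9K i).dist a a'))) := by
  have hγ : ∀ (z : SiteY i) (a : 𝔸), ‖R (gSiteY i u z) a‖ ≤ ‖a‖ ∧ ‖R (gSiteY i u z)⁻¹ a‖ ≤ ‖a‖ := fun z a =>
    ⟨norm_R_le (hu _).1 (hu _).2 a, norm_R_inv_le (hu _).1 (hu _).2 a⟩
  set M : Module.End ℝ (SiteY i → 𝔸) := W.restrictScalars ℝ with hM
  have hop : mulOp (fun p : SiteY i × ι => f p.1) * conj b (W'.restrictScalars ℝ) =
      conj b ((cutMulY (𝔸 := 𝔸) f).restrictScalars ℝ ∘ₗ (conjY (gSiteY i u)⁻¹).restrictScalars ℝ ∘ₗ M ∘ₗ (conjY (gSiteY i u)).restrictScalars ℝ) := by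
    rw [← conj_cutMulY b f, ← B9Eq352DivFormLetters.conj_mul, hrot, hM]
    exact congrArg (conj b) (LinearMap.ext fun Λ => rfl)
  rw [hop]
  -- the row profile on cube blocks: the indicator of the blocks carrying an active row
  set G₁ : BlkCubeY i c → ℝ := fun s => if ∃ z : SiteY i, blkCubeY i c z = s ∧ f z ≠ 0 then (1 : ℝ) else 0 with hG₁
  have hG₁f : ∀ z, |f z| ≤ G₁ (blkCubeY i c z) := fun z => by
    by_cases hz : f z = 0
    · rw [hz, abs_zero]; rw [hG₁]; dsimp only; split_ifs <;> norm_num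
    · rw [hG₁]; dsimp only; rw [if_pos ⟨z, rfl, hz⟩]; exact hf1 z
  have hK : ∀ (z : SiteY i) (a' : IBondY i),
      G₁ (blkCubeY i c z) * ((geoCK i c).len (blkCubeY i c z) ^ 4)⁻¹ * (BS * B6.c1 dBc δS αc) *
          Real.exp (-((1 - αc) * δS * (geo9K i).dist (ιB (blkOf i.D.toDomains z)) a')) ≤
        (BS * B6.c1 dBc δS αc) * ((geo9K i).len (ιB (blkOf i.D.toDomains z)) ^ 4)⁻¹ *
          Real.exp (-((1 - αc) * δS * (geo9K i).dist (ιB (blkOf i.D.toDomains z)) a')) := fun z a' => by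
    have hc1 : 0 ≤ B6.c1 dBc δS αc := c1_nonneg _ _ _
    have hlz := geo9K_len_pos i (ιB (blkOf i.D.toDomains z))
    by_cases hz : ∃ z' : SiteY i, blkCubeY i c z' = blkCubeY i c z ∧ f z' ≠ 0
    · obtain ⟨z', hz', hf'⟩ := hz
      have hlen : (geoCK i c).len (blkCubeY i c z) = (geo9K i).len (ιB (blkOf i.D.toDomains z)) := by
        rw [← hz', len_cube_eq_len_member_of_nearH i c ιB hι (hfnear z' hf'), blkOf_eq_of_blkCubeY_eq i c hz']
      rw [hG₁]; dsimp only; rw [if_pos ⟨z', hz', hf'⟩, hlen]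
      exact le_of_eq (by ring)
    · rw [hG₁]; dsimp only; rw [if_neg hz, zero_mul, zero_mul, zero_mul]
      positivity
  refine hasMajorant_mono (g := toB6 (geo9K i) Rr' Hp) _
    (hasMajorant_conj_site_sandwich_src_global i c b hM₂ hrepr (gSiteY i u) hγ f G₁ hG₁f ιB hι Rr H Rr' Hp dBc hBS hδS hαc1
      (fun s => ((geoCK i c).len s ^ 4)⁻¹) (fun s => inv_nonneg.2 (pow_nonneg (geoCK_len_pos i c s).le _)) h261c
      (K := fun a a' => (BS * B6.c1 dBc δS αc) * ((geo9K i).len a ^ 4)⁻¹ * Real.exp (-((1 - αc) * δS * (geo9K i).dist a a'))) hK M hSc)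
    fun a a' => le_of_eq (by ring)

end Transfer

/-! ## §3  FILE 7's displayed tails on the member carrier: `hTail0∕1∕2 □ ν`, `hSbL □`, `hGw □ ν`, `hPb □` -/

section Tails

variable [Fintype (geo9K i).Site] {Rr : ℝ} {H : Prop} {Rr' : ℝ} {Hp : Prop}

omit [Fintype (geo9K i).Site] in
/-- arithmetic: `ℓ⁻⁴·ℓ = ℓ⁻³` (`ℓ > 0`). [folklore] -/
private theorem pow4_inv_mul_self {x : ℝ} (hx : 0 < x) : (x ^ 4)⁻¹ * x = (x ^ 3)⁻¹ := by
  have hx' := hx.ne'; field_simp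
omit [Fintype (geo9K i).Site] in
/-- arithmetic: `ℓ²·ℓ⁻³ = ℓ⁻¹` (`ℓ > 0`). [folklore] -/
private theorem sq_mul_pow3_inv {x : ℝ} (hx : 0 < x) : x ^ 2 * (x ^ 3)⁻¹ = x⁻¹ := by
  have hx' := hx.ne'; field_simp
omit [Fintype (geo9K i).Site] in
/-- arithmetic: `ℓ⁴·ℓ⁻³ = ℓ` (`ℓ > 0`). [folklore] -/
private theorem pow4_mul_pow3_inv {x : ℝ} (hx : 0 < x) : x ^ 4 * (x ^ 3)⁻¹ = x := by
  have hx' := hx.ne'; field_simp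

omit [Fintype (geo9K i).Site] in
open Classical in
/-- the site indicator `𝟙[NearC(3S_j)]` is a near cut-off. [cite: Balaban1985BackgroundPropagators, p.408, bookkeeping] -/
theorem ind_near : (∀ z : SiteY i, |(if NearC i c (3 * SC i c) z.1 then (1 : ℝ) else 0)| ≤ 1) ∧
    (∀ z : SiteY i, (if NearC i c (3 * SC i c) z.1 then (1 : ℝ) else 0) ≠ 0 → NearH c z.1) := by
  refine ⟨fun z => by split_ifs <;> simp, fun z hz => ?_⟩
  by_cases h : NearC i c (3 * SC i c) z.1
  · exact nearH_of_nearC i c le_rfl h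
  · exact absurd (by rw [if_neg h]) hz

open Classical in
set_option maxHeartbeats 1600000 in
/-- ★★★ **FILE 7's `hTail0 □ ν`**: `conj(sS_□(V′))·M_{𝟙[NearC 3S]}♯·(right entry) ≺ κ_{T0}·ℓ(a)⁻³·e^{−r_Rd}` — §2's `hasMajorant_conj_resolventCube_mul_cut_member` chained
([4] (2.60)–(2.61), FILE 4) with the displayed right entry (FILE 8a `hasMajorant_rightEntry_at`: `≺ κ_R·ℓ(a)·e^{−r_Rd}`); `r_R + (α + β)δ₀ ≤ δ_S − α_cδ_S − αδ₀`.
[cite: Balaban1985BackgroundPropagators, p.415 l.26–37, (3.48) p.398, Cor. 3.6 p.408; Balaban1984PropagatorsII, Lemma 2.1 (2.60)–(2.61) p.234, (2.51) p.232] -/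
theorem hasMajorant_tail0_at {M₂ : ℝ} (hM₂ : 0 ≤ M₂) (hrepr : ∀ (v : 𝔸) (j : ι), |b.repr v j| ≤ M₂ * ‖v‖)
    (u : GaugeY 𝔸 i) (hu : ∀ x, ‖((u x : 𝔸ˣ) : 𝔸)‖ ≤ 1 ∧ ‖(((u x)⁻¹ : 𝔸ˣ) : 𝔸)‖ ≤ 1) (V : CfgY 𝔸 i)
    (ιB : BlkY i → IBondY i) (hι : ∀ s, β i.hN i.D i.hk (ιB s) = s) (σ : ℂ)
    {BS δS αc Cc : ℝ} (hBS : 0 ≤ BS) (hCc : 0 ≤ Cc) (hrc : 0 ≤ δS - αc * δS)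
    (hSTc : ScaleTransfer (geoCK i c) δS αc Cc (fun a => ((geoCK i c).len a ^ 4)⁻¹))
    (hSc : HasMajorant (g := toB6 (geoCK i c) Rr H) (fun p : SiteY i × ι => blkCubeY i c p.1)
      (conj b ((σ • (QpsCubeY i c (parSymY i) V ∘ₗ XinvCubeY i c (parSymY i) V ∘ₗ QpCubeY i c (parSymY i) V)).restrictScalars ℝ))
      (fun a s => BS * ((geoCK i c).len a ^ 4)⁻¹ * Real.exp (-(δS * (geoCK i c).dist a s))))
    (dB : ℕ) {δ₀ α β' C4 Λ κR rR : ℝ} (hC4 : 0 ≤ C4) (hκR : 0 ≤ κR) (hΛ : 0 ≤ Λ) (hrR : 0 ≤ rR) (hbud : rR + (α + β') * δ₀ ≤ δS - αc * δS - α * δ₀)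
    (hST4 : ScaleTransfer (geo9K i) δ₀ α C4 (fun a => ((geo9K i).len a ^ 4)⁻¹)) (hST1 : ScaleTransfer (geo9K i) δ₀ α Λ (fun a => (geo9K i).len a))
    (h261 : Ineq261 dB (toB6 (geo9K i) Rr' Hp) δ₀ β')
    {Rop : Module.End ℝ (SiteY i × ι → ℝ)}
    (hRop : HasMajorant (g := toB6 (geo9K i) Rr' Hp) (fun p : SiteY i × ι => ιB (blkOf i.D.toDomains p.1)) Rop
      (fun a a' => κR * (geo9K i).len a * Real.exp (-(rR * (geo9K i).dist a a')))) :
    HasMajorant (g := toB6 (geo9K i) Rr' Hp) (fun p : SiteY i × ι => ιB (blkOf i.D.toDomains p.1))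
      (conj b ((σ • (QpsCubeY i c (parSymY i) (gaugeY i u⁻¹ V) ∘ₗ XinvCubeY i c (parSymY i) (gaugeY i u⁻¹ V) ∘ₗ
          QpCubeY i c (parSymY i) (gaugeY i u⁻¹ V))).restrictScalars ℝ) *
        mulOp (fun p : SiteY i × ι => if NearC i c (3 * SC i c) p.1.1 then (1 : ℝ) else 0) * Rop)
      (fun a a' => (((M₂ * ∑ j, ‖b j‖) ^ 2 * (BS * Cc) * C4) * κR * Λ * B6.c1 dB δ₀ β') * ((geo9K i).len a ^ 3)⁻¹ *
        Real.exp (-(rR * (geo9K i).dist a a'))) := by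
  obtain ⟨htri, hsymm, hdnn⟩ := geo9K_axioms i Rr' Hp
  have hlen0 : ∀ y : (geo9K i).Site, 0 ≤ (geo9K i).len y := fun y => (geo9K_len_pos i y).le
  have hT := hasMajorant_conj_cubeWord_mul_cut_member i c b (Rr := Rr) (H := H) (Rr' := Rr') (Hp := Hp) hM₂ hrepr u hu ιB hι _ _
    (smul_resolventWordCube_gauge_inv_eq i c σ u V)
    (fun z : SiteY i => if NearC i c (3 * SC i c) z.1 then (1 : ℝ) else 0) (ind_near i c).1 (ind_near i c).2 hBS hCc hrc hSTc hSc hST4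
  have h := mul_decay_majorant_blk (Rg := Rr') (Hg := Hp) (fun p : SiteY i × ι => ιB (blkOf i.D.toDomains p.1)) dB
    (fun a => ((geo9K i).len a ^ 4)⁻¹) (fun a => (geo9K i).len a) (by positivity : 0 ≤ (M₂ * ∑ j, ‖b j‖) ^ 2 * (BS * Cc) * C4) hκR hΛ
    (fun a => inv_nonneg.2 (pow_nonneg (hlen0 a) _)) hlen0 hrR hbud hdnn htri hST1 h261 hT hRop
  refine hasMajorant_mono (g := toB6 (geo9K i) Rr' Hp) _ h fun a a' => le_of_eq ?_
  rw [pow4_inv_mul_self (geo9K_len_pos i a)]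

set_option maxHeartbeats 1600000 in
/-- ★★★ **FILE 7's `hTail1 □ ν`**: `conj(η²G′_□(V′))·(tail 0) ≺ κ_{T1}·ℓ(a)⁻¹·e^{−r_Td}` — §2's `hasMajorant_conj_GpCube_member` chained with a displayed tail-0 majorant
(`≺ κ_{T0}·ℓ⁻³·e^{−r_Td}`, `r_T + (α + β)δ₀ ≤ (1 − α_c)δ_B`). [cite: Balaban1985BackgroundPropagators, p.415 l.26–37, (3.42) p.397, Cor. 3.6 p.408; Balaban1984PropagatorsII, Lemma 2.1 (2.60)–(2.61) p.234] -/
theorem hasMajorant_tail1_at {M₂ : ℝ} (hM₂ : 0 ≤ M₂) (hrepr : ∀ (v : 𝔸) (j : ι), |b.repr v j| ≤ M₂ * ‖v‖)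
    (u : GaugeY 𝔸 i) (hu : ∀ x, ‖((u x : 𝔸ˣ) : 𝔸)‖ ≤ 1 ∧ ‖(((u x)⁻¹ : 𝔸ˣ) : 𝔸)‖ ≤ 1) (V : CfgY 𝔸 i)
    (ιB : BlkY i → IBondY i) (hι : ∀ s, β i.hN i.D i.hk (ιB s) = s) (e : ℂ)
    (dBc : ℕ) {Bf δB αc : ℝ} (hBf : 0 ≤ Bf) (hδB : 0 ≤ δB) (hαc1 : αc ≤ 1) (h261c : Ineq261 dBc (toB6 (geoCK i c) Rr H) δB αc)
    (hBc : HasMajorant (g := toB6 (geoCK i c) Rr H) (fun p : SiteY i × ι => blkCubeY i c p.1) (conj b ((e • GpCubeY i c (parSymY i) V).restrictScalars ℝ))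
      (fun a s => Bf * (geoCK i c).len a ^ 2 * Real.exp (-(δB * (geoCK i c).dist a s))))
    (dB : ℕ) {δ₀ α β' C3 κT rT : ℝ} (hκT : 0 ≤ κT) (hC3 : 0 ≤ C3) (hrT : 0 ≤ rT) (hbud : rT + (α + β') * δ₀ ≤ (1 - αc) * δB)
    (hST3 : ScaleTransfer (geo9K i) δ₀ α C3 (fun a => ((geo9K i).len a ^ 3)⁻¹)) (h261 : Ineq261 dB (toB6 (geo9K i) Rr' Hp) δ₀ β')
    {Tail : Module.End ℝ (SiteY i × ι → ℝ)}
    (hTail : HasMajorant (g := toB6 (geo9K i) Rr' Hp) (fun p : SiteY i × ι => ιB (blkOf i.D.toDomains p.1)) Tail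
      (fun a a' => κT * ((geo9K i).len a ^ 3)⁻¹ * Real.exp (-(rT * (geo9K i).dist a a')))) :
    HasMajorant (g := toB6 (geo9K i) Rr' Hp) (fun p : SiteY i × ι => ιB (blkOf i.D.toDomains p.1))
      (conj b ((e • GpCubeY i c (parSymY i) (gaugeY i u⁻¹ V)).restrictScalars ℝ) * Tail)
      (fun a a' => (((M₂ * ∑ j, ‖b j‖) ^ 2 * (Bf * B6.c1 dBc δB αc)) * κT * C3 * B6.c1 dB δ₀ β') * ((geo9K i).len a)⁻¹ *
        Real.exp (-(rT * (geo9K i).dist a a'))) := by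
  obtain ⟨htri, hsymm, hdnn⟩ := geo9K_axioms i Rr' Hp
  have hlen0 : ∀ y : (geo9K i).Site, 0 ≤ (geo9K i).len y := fun y => (geo9K_len_pos i y).le
  have hc1 : 0 ≤ B6.c1 dBc δB αc := c1_nonneg _ _ _
  have hB := hasMajorant_conj_GpCube_member i c b (Rr := Rr) (H := H) (Rr' := Rr') (Hp := Hp) hM₂ hrepr u hu V ιB hι e dBc hBf hδB hαc1 h261c hBc
  have h := mul_decay_majorant_blk (Rg := Rr') (Hg := Hp) (fun p : SiteY i × ι => ιB (blkOf i.D.toDomains p.1)) dB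
    (fun a => (geo9K i).len a ^ 2) (fun a => ((geo9K i).len a ^ 3)⁻¹) (by positivity : 0 ≤ (M₂ * ∑ j, ‖b j‖) ^ 2 * (Bf * B6.c1 dBc δB αc)) hκT hC3
    (fun a => pow_nonneg (hlen0 a) _) (fun a => inv_nonneg.2 (pow_nonneg (hlen0 a) _)) hrT hbud hdnn htri hST3 h261 hB hTail
  refine hasMajorant_mono (g := toB6 (geo9K i) Rr' Hp) _ h fun a a' => le_of_eq ?_
  rw [sq_mul_pow3_inv (geo9K_len_pos i a)]

set_option maxHeartbeats 1600000 in
/-- ★★★ **FILE 7's `hTail2 □ ν`**: `conj(η²G′_□(V′))·conj(η²G′_□(V′))·(tail 0) ≺ κ_{T2}·ℓ(a)·e^{−r_Td}` — two cube letters chained first (weight `ℓ⁴`), then the tail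
(`r_T + (α + β)δ₀ ≤ r_B`, `r_B + (α + β)δ₀ ≤ (1 − α_c)δ_B`). [cite: Balaban1985BackgroundPropagators, p.415 l.26–37, (3.42) p.397, Cor. 3.6 p.408; Balaban1984PropagatorsII, Lemma 2.1 (2.60)–(2.61) p.234] -/
theorem hasMajorant_tail2_at {M₂ : ℝ} (hM₂ : 0 ≤ M₂) (hrepr : ∀ (v : 𝔸) (j : ι), |b.repr v j| ≤ M₂ * ‖v‖)
    (u : GaugeY 𝔸 i) (hu : ∀ x, ‖((u x : 𝔸ˣ) : 𝔸)‖ ≤ 1 ∧ ‖(((u x)⁻¹ : 𝔸ˣ) : 𝔸)‖ ≤ 1) (V : CfgY 𝔸 i)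
    (ιB : BlkY i → IBondY i) (hι : ∀ s, β i.hN i.D i.hk (ιB s) = s) (e : ℂ)
    (dBc : ℕ) {Bf δB αc : ℝ} (hBf : 0 ≤ Bf) (hδB : 0 ≤ δB) (hαc1 : αc ≤ 1) (h261c : Ineq261 dBc (toB6 (geoCK i c) Rr H) δB αc)
    (hBc : HasMajorant (g := toB6 (geoCK i c) Rr H) (fun p : SiteY i × ι => blkCubeY i c p.1) (conj b ((e • GpCubeY i c (parSymY i) V).restrictScalars ℝ))
      (fun a s => Bf * (geoCK i c).len a ^ 2 * Real.exp (-(δB * (geoCK i c).dist a s))))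
    (dB : ℕ) {δ₀ α β' C2 C3 κT rT rB : ℝ} (hκT : 0 ≤ κT) (hC2 : 0 ≤ C2) (hC3 : 0 ≤ C3) (hrT : 0 ≤ rT) (hrB : 0 ≤ rB) (hε0 : 0 ≤ (α + β') * δ₀)
    (hbud : rT + (α + β') * δ₀ ≤ rB) (hbudB : rB + (α + β') * δ₀ ≤ (1 - αc) * δB)
    (hST2 : ScaleTransfer (geo9K i) δ₀ α C2 (fun a => (geo9K i).len a ^ 2)) (hST3 : ScaleTransfer (geo9K i) δ₀ α C3 (fun a => ((geo9K i).len a ^ 3)⁻¹))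
    (h261 : Ineq261 dB (toB6 (geo9K i) Rr' Hp) δ₀ β')
    {Tail : Module.End ℝ (SiteY i × ι → ℝ)}
    (hTail : HasMajorant (g := toB6 (geo9K i) Rr' Hp) (fun p : SiteY i × ι => ιB (blkOf i.D.toDomains p.1)) Tail
      (fun a a' => κT * ((geo9K i).len a ^ 3)⁻¹ * Real.exp (-(rT * (geo9K i).dist a a')))) :
    HasMajorant (g := toB6 (geo9K i) Rr' Hp) (fun p : SiteY i × ι => ιB (blkOf i.D.toDomains p.1))
      (conj b ((e • GpCubeY i c (parSymY i) (gaugeY i u⁻¹ V)).restrictScalars ℝ) *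
        conj b ((e • GpCubeY i c (parSymY i) (gaugeY i u⁻¹ V)).restrictScalars ℝ) * Tail)
      (fun a a' => ((((M₂ * ∑ j, ‖b j‖) ^ 2 * (Bf * B6.c1 dBc δB αc)) * ((M₂ * ∑ j, ‖b j‖) ^ 2 * (Bf * B6.c1 dBc δB αc)) * C2 *
          B6.c1 dB δ₀ β') * κT * C3 * B6.c1 dB δ₀ β') * (geo9K i).len a * Real.exp (-(rT * (geo9K i).dist a a'))) := by
  obtain ⟨htri, hsymm, hdnn⟩ := geo9K_axioms i Rr' Hp
  have hlen0 : ∀ y : (geo9K i).Site, 0 ≤ (geo9K i).len y := fun y => (geo9K_len_pos i y).le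
  have hc1 : 0 ≤ B6.c1 dBc δB αc := c1_nonneg _ _ _
  have hc1' : 0 ≤ B6.c1 dB δ₀ β' := c1_nonneg _ _ _
  have hB := hasMajorant_conj_GpCube_member i c b (Rr := Rr) (H := H) (Rr' := Rr') (Hp := Hp) hM₂ hrepr u hu V ιB hι e dBc hBf hδB hαc1 h261c hBc
  have hB' : HasMajorant (g := toB6 (geo9K i) Rr' Hp) (fun p : SiteY i × ι => ιB (blkOf i.D.toDomains p.1))
      (conj b ((e • GpCubeY i c (parSymY i) (gaugeY i u⁻¹ V)).restrictScalars ℝ))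
      (fun a a' => (M₂ * ∑ j, ‖b j‖) ^ 2 * (Bf * B6.c1 dBc δB αc) * (geo9K i).len a ^ 2 * Real.exp (-(rB * (geo9K i).dist a a'))) := by
    refine hasMajorant_mono (g := toB6 (geo9K i) Rr' Hp) _ hB fun a a' => mul_le_mul_of_nonneg_left (Real.exp_le_exp.2 (neg_le_neg ?_)) ?_
    · exact mul_le_mul_of_nonneg_right (by linarith : rB ≤ (1 - αc) * δB) (hdnn a a')
    · have := hlen0 a; positivity
  have hBB := mul_decay_majorant_blk (Rg := Rr') (Hg := Hp) (fun p : SiteY i × ι => ιB (blkOf i.D.toDomains p.1)) dB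
    (fun a => (geo9K i).len a ^ 2) (fun a => (geo9K i).len a ^ 2) (by positivity : 0 ≤ (M₂ * ∑ j, ‖b j‖) ^ 2 * (Bf * B6.c1 dBc δB αc))
    (by positivity : 0 ≤ (M₂ * ∑ j, ‖b j‖) ^ 2 * (Bf * B6.c1 dBc δB αc)) hC2
    (fun a => pow_nonneg (hlen0 a) _) (fun a => pow_nonneg (hlen0 a) _) hrB hbudB hdnn htri hST2 h261 hB hB'
  have hBB' : HasMajorant (g := toB6 (geo9K i) Rr' Hp) (fun p : SiteY i × ι => ιB (blkOf i.D.toDomains p.1))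
      (conj b ((e • GpCubeY i c (parSymY i) (gaugeY i u⁻¹ V)).restrictScalars ℝ) * conj b ((e • GpCubeY i c (parSymY i) (gaugeY i u⁻¹ V)).restrictScalars ℝ))
      (fun a a' => ((M₂ * ∑ j, ‖b j‖) ^ 2 * (Bf * B6.c1 dBc δB αc) * ((M₂ * ∑ j, ‖b j‖) ^ 2 * (Bf * B6.c1 dBc δB αc)) * C2 * B6.c1 dB δ₀ β') *
        (geo9K i).len a ^ 4 * Real.exp (-(rB * (geo9K i).dist a a'))) :=
    hasMajorant_mono (g := toB6 (geo9K i) Rr' Hp) _ hBB fun a a' => le_of_eq (by ring)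
  have h := mul_decay_majorant_blk (Rg := Rr') (Hg := Hp) (fun p : SiteY i × ι => ιB (blkOf i.D.toDomains p.1)) dB
    (fun a => (geo9K i).len a ^ 4) (fun a => ((geo9K i).len a ^ 3)⁻¹) (by positivity) hκT hC3
    (fun a => pow_nonneg (hlen0 a) _) (fun a => inv_nonneg.2 (pow_nonneg (hlen0 a) _)) hrT hbud hdnn htri hST3 h261 hBB' hTail
  refine hasMajorant_mono (g := toB6 (geo9K i) Rr' Hp) _ h fun a a' => le_of_eq ?_
  rw [pow4_mul_pow3_inv (geo9K_len_pos i a)]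

open Classical in
/-- ★★★ **FILE 7's `hSbL □`** = §2's `hasMajorant_cut_mul_conj_resolventCube_member` at `f = 𝟙[NearC 3S_j]`.
[cite: Balaban1985BackgroundPropagators, p.415 l.26–37, Thm 3.2 (3.48) p.398, Cor. 3.6 p.408; Balaban1984PropagatorsII, (2.51) p.232, Lemma 2.1 (2.61) p.234] -/
theorem hasMajorant_sbL_at {M₂ : ℝ} (hM₂ : 0 ≤ M₂) (hrepr : ∀ (v : 𝔸) (j : ι), |b.repr v j| ≤ M₂ * ‖v‖)
    (u : GaugeY 𝔸 i) (hu : ∀ x, ‖((u x : 𝔸ˣ) : 𝔸)‖ ≤ 1 ∧ ‖(((u x)⁻¹ : 𝔸ˣ) : 𝔸)‖ ≤ 1) (V : CfgY 𝔸 i)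
    (ιB : BlkY i → IBondY i) (hι : ∀ s, β i.hN i.D i.hk (ιB s) = s) (σ : ℂ)
    (dBc : ℕ) {BS δS αc : ℝ} (hBS : 0 ≤ BS) (hδS : 0 ≤ δS) (hαc1 : αc ≤ 1) (h261c : Ineq261 dBc (toB6 (geoCK i c) Rr H) δS αc)
    (hSc : HasMajorant (g := toB6 (geoCK i c) Rr H) (fun p : SiteY i × ι => blkCubeY i c p.1)
      (conj b ((σ • (QpsCubeY i c (parSymY i) V ∘ₗ XinvCubeY i c (parSymY i) V ∘ₗ QpCubeY i c (parSymY i) V)).restrictScalars ℝ))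
      (fun a s => BS * ((geoCK i c).len a ^ 4)⁻¹ * Real.exp (-(δS * (geoCK i c).dist a s)))) :
    HasMajorant (g := toB6 (geo9K i) Rr' Hp) (fun p : SiteY i × ι => ιB (blkOf i.D.toDomains p.1))
      (mulOp (fun p : SiteY i × ι => if NearC i c (3 * SC i c) p.1.1 then (1 : ℝ) else 0) *
        conj b ((σ • (QpsCubeY i c (parSymY i) (gaugeY i u⁻¹ V) ∘ₗ XinvCubeY i c (parSymY i) (gaugeY i u⁻¹ V) ∘ₗ
          QpCubeY i c (parSymY i) (gaugeY i u⁻¹ V))).restrictScalars ℝ))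
      (fun a a' => ((M₂ * ∑ j, ‖b j‖) ^ 2 * (BS * B6.c1 dBc δS αc)) * ((geo9K i).len a ^ 4)⁻¹ * Real.exp (-((1 - αc) * δS * (geo9K i).dist a a'))) :=
  hasMajorant_cut_mul_conj_cubeWord_member i c b hM₂ hrepr u hu ιB hι _ _ (smul_resolventWordCube_gauge_inv_eq i c σ u V) _
    (ind_near i c).1 (ind_near i c).2 dBc hBS hδS hαc1 h261c hSc

set_option maxHeartbeats 1600000 in
/-- ★★★ **FILE 7's `hPb □`**: the cube projection `Q′*_□Q′_□(V′)` is block-local on the MEMBER carrier — FILE 3's `hasMajorant_conj_projCube` on the cube carrier (r05∕p21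
`hasMajorantHom_conjHom_QpCubeY` ∕ `_QpsCubeY` at the bi-contractive transporters of `V′`), coarsened by FILE 4's `hasMajorant_diag_coarsen` (a cube block lies in one member block).
[cite: Balaban1985BackgroundPropagators, (3.19)–(3.21) pp.393–394, p.408, p.409 l.1–5; Balaban1984PropagatorsII, (2.45) p.231, (2.51) p.232] -/
theorem hasMajorant_projCube_member [DecidableEq (geo9K i).Site] (Rr : ℝ) (H : Prop) {M₂ : ℝ} (hM₂ : 0 ≤ M₂) (hrepr : ∀ (v : 𝔸) (j : ι), |b.repr v j| ≤ M₂ * ‖v‖) (V' : CfgY 𝔸 i)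
    (hparV : ∀ z w : SiteY i, ‖(parSymY i V' z w : 𝔸)‖ ≤ 1 ∧ ‖(((parSymY i V' z w)⁻¹ : 𝔸ˣ) : 𝔸)‖ ≤ 1)
    (ιB : BlkY i → IBondY i) :
    HasMajorant (g := toB6 (geo9K i) Rr' Hp) (fun p : SiteY i × ι => ιB (blkOf i.D.toDomains p.1))
      (conj b ((QpsCubeY i c (parSymY i) V' ∘ₗ QpCubeY i c (parSymY i) V').restrictScalars ℝ))
      (fun a a' : (geo9K i).Site => if a = a' then (M₂ * ∑ j, ‖b j‖) ^ 2 else 0) := by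
  have hQ := B9Cor36CubeSandwichQ.hasMajorantHom_conjHom_QpCubeY i c b (parSymY i) V' (Rr := Rr) (Hp := H) hparV hM₂ hrepr
  have hQs := B9Cor36CubeSandwichQ.hasMajorantHom_conjHom_QpsCubeY i c b (parSymY i) V' (Rr := Rr) (Hp := H) hparV hM₂ hrepr
  have hP := B9Eq3105FamThreeLocCDiffAtoms.hasMajorant_conj_projCube i b c (parSymY i) V' (Rr := Rr) (Hp := H)
    (mul_nonneg hM₂ (Finset.sum_nonneg fun _ _ => norm_nonneg _)) hQ hQs
  letI instD : DecidableEq (toB6 (geoCK i c) Rr H).Site := inferInstanceAs (DecidableEq (BlkCubeY i c))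
  exact B9Eq3105FamThreeLocCDiffChains.hasMajorant_diag_coarsen (g := geo9K i) (Rg := Rr') (Hg := Hp) (G₁ := toB6 (geoCK i c) Rr H)
    (fun p : SiteY i × ι => blkCubeY i c p.1) (fun p : SiteY i × ι => ιB (blkOf i.D.toDomains p.1))
    (fun x x' h => congrArg ιB (blkOf_eq_of_blkCubeY_eq i c h.symm).symm) hP

end Tails

/-! ## §4  FILE 7's `hGw □ ν` — the resolvent word against the right entry, no cut-off in between (FILE 8a's prefixed right entry) -/

section Gw

variable [Fintype (geo9K i).Site] [DecidableEq (geo9K i).Site] {Rr : ℝ} {H : Prop} {Rr' : ℝ} {Hp : Prop}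
variable {B : B9.Backgrounds} (cfg : B.Cfg → CfgY 𝔸 i) {U₁ : B.Cfg}

open Classical in
set_option maxHeartbeats 3200000 in
/-- ★★★ **FILE 7's `hGw □ ν`**: `conj(sS_□(V′))·(conj(η²G′_□(V′))·M_{χl}♯·conj(−η⁻¹∇*_ν)) ≺ κ_G·ℓ(a)⁻³·e^{−ρδ₀d}` — FILE 8a's `hasMajorant_mul_rightEntry_at` with
`T = conj(sS_□(V′))`: `T·M_{χ_□}♯` is §2's transfer at `f = χ_□` (sources within `7S_j∕2`), `T·conj((G′_□K_χ)(V′)^ℝ)` is displayed (the cube word `S_□G′_□K_χ`, rows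
global, sources in the transition annulus; supplier: the cube chain + §2's transfer, next file).
[cite: Balaban1985BackgroundPropagators, p.415 l.26–37, (3.97) p.412, (3.100) p.413, Thm 3.2 (3.48) p.398, Cor. 3.6 p.408; Balaban1983RegularityDecay, (1.11)–(1.12) (statement type); Balaban1984PropagatorsII, (2.51) p.232, Lemma 2.1 (2.60)–(2.61) p.234] -/
theorem hasMajorant_gw_at {BG δG : ℝ} (hE : B9FromB6.EBlock (B9CubeLettersInvReadings.kernelFamilySInv i B cfg (fun W => Node00.GpY i (parSymY i) W) (parSymY i)) BG δG U₁)
    (hBG : 0 ≤ BG) (ιB : BlkY i → IBondY i) (hι : ∀ s, β i.hN i.D i.hk (ιB s) = s)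
    {M₂ : ℝ} (hM₂ : 0 ≤ M₂) (hrepr : ∀ (v : 𝔸) (j : ι), |b.repr v j| ≤ M₂ * ‖v‖) (hη : etaS i = |i.cf|⁻¹) (ν : Fin (d + 1))
    (u : GaugeY 𝔸 i) (hu : ∀ x, ‖((u x : 𝔸ˣ) : 𝔸)‖ ≤ 1 ∧ ‖(((u x)⁻¹ : 𝔸ˣ) : 𝔸)‖ ≤ 1) (η : ℝ) (A : B9Eq360DeltaPrimeAY.AfldY 𝔸 i)
    {Q : Set (Site (PV d ℓ i.m i.K hd hL) 0)}
    (hQ : ∀ x : Site (PV d ℓ i.m i.K hd hL) 0, NearC i c (35 * SC i c / 8 + 1) (boxEquiv i.hN x).1 → x ∈ Q)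
    (hgA : ∀ (κ : Fin (d + 1)) (x : Site (PV d ℓ i.m i.K hd hL) 0), x ∈ Q → x.shift κ ∈ Q → gaugeY i u (cfg U₁) κ x = B9Eq39Adjoint.fluct η A κ x)
    (hU : IsUnit (Node00.deltaPrimeAY i (parSymY i) (cfg U₁)))
    (hV : IsUnit (B9CubeLettersOpsL0.deltaPrimeACubeY i c (parSymY i) (gaugeY i u⁻¹ (B9Cor36CubeCutoffs.locCfgY i c η A))))
    (σ : ℂ) {BS δS αc Cc : ℝ} (hBS : 0 ≤ BS) (hCc : 0 ≤ Cc) (hrc : 0 ≤ δS - αc * δS)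
    (hSTc : ScaleTransfer (geoCK i c) δS αc Cc (fun a => ((geoCK i c).len a ^ 4)⁻¹))
    (hSc : HasMajorant (g := toB6 (geoCK i c) Rr H) (fun p : SiteY i × ι => blkCubeY i c p.1)
      (conj b ((σ • (QpsCubeY i c (parSymY i) (B9Cor36CubeCutoffs.locCfgY i c η A) ∘ₗ XinvCubeY i c (parSymY i) (B9Cor36CubeCutoffs.locCfgY i c η A) ∘ₗ
          QpCubeY i c (parSymY i) (B9Cor36CubeCutoffs.locCfgY i c η A))).restrictScalars ℝ))
      (fun a s => BS * ((geoCK i c).len a ^ 4)⁻¹ * Real.exp (-(δS * (geoCK i c).dist a s))))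
    (dB : ℕ) {δ₀ aG α Λ ρ β' C4 κ₂ : ℝ} (hδ₀ : 0 ≤ δ₀) (haG : aG * δ₀ ≤ δG) (hα : 0 ≤ α) (hΛ : 0 ≤ Λ)
    (hT1 : ScaleTransfer (geo9K i) δ₀ α Λ (fun a => (geo9K i).len a)) (hρ : 0 ≤ ρ) (hρG : ρ ≤ aG - α)
    (h261 : Ineq261 dB (toB6 (geo9K i) Rr' Hp) δ₀ β') (hC4 : 0 ≤ C4) (hST4 : ScaleTransfer (geo9K i) δ₀ α C4 (fun a => ((geo9K i).len a ^ 4)⁻¹))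
    (hκ₂ : 0 ≤ κ₂) (hbud : ρ * δ₀ + (α + β') * δ₀ ≤ δS - αc * δS - α * δ₀)
    (hTK : HasMajorant (g := toB6 (geo9K i) Rr' Hp) (fun p : SiteY i × ι => ιB (blkOf i.D.toDomains p.1))
      (conj b ((σ • (QpsCubeY i c (parSymY i) (gaugeY i u⁻¹ (B9Cor36CubeCutoffs.locCfgY i c η A)) ∘ₗ
          XinvCubeY i c (parSymY i) (gaugeY i u⁻¹ (B9Cor36CubeCutoffs.locCfgY i c η A)) ∘ₗ
          QpCubeY i c (parSymY i) (gaugeY i u⁻¹ (B9Cor36CubeCutoffs.locCfgY i c η A)))).restrictScalars ℝ) *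
        conj b (((B9CubeLettersOpsL0.GpCubeY i c (parSymY i) (gaugeY i u⁻¹ (B9Cor36CubeCutoffs.locCfgY i c η A)) *
          (B9CubeLettersOpsL0.deltaPrimeACubeY i c (parSymY i) (gaugeY i u⁻¹ (B9Cor36CubeCutoffs.locCfgY i c η A)) * cutMulY (𝔸 := 𝔸) (B9Cor36CubeCutoffs.chiY i c) -
            cutMulY (𝔸 := 𝔸) (B9Cor36CubeCutoffs.chiY i c) * B9CubeLettersOpsL0.deltaPrimeACubeY i c (parSymY i) (gaugeY i u⁻¹ (B9Cor36CubeCutoffs.locCfgY i c η A)))).restrictScalars ℝ :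
        Module.End ℝ (SiteY i → 𝔸))))
      (fun (a a' : (geo9K i).Site) => κ₂ * ((geo9K i).len a ^ 4)⁻¹ * Real.exp (-((δS - αc * δS - α * δ₀) * (geo9K i).dist a a')))) :
    HasMajorant (g := toB6 (geo9K i) Rr' Hp) (fun p : SiteY i × ι => ιB (blkOf i.D.toDomains p.1))
      (conj b ((σ • (QpsCubeY i c (parSymY i) (gaugeY i u⁻¹ (B9Cor36CubeCutoffs.locCfgY i c η A)) ∘ₗ
          XinvCubeY i c (parSymY i) (gaugeY i u⁻¹ (B9Cor36CubeCutoffs.locCfgY i c η A)) ∘ₗ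
          QpCubeY i c (parSymY i) (gaugeY i u⁻¹ (B9Cor36CubeCutoffs.locCfgY i c η A)))).restrictScalars ℝ) *
        (conj b (((((etaS i ^ 2 : ℝ) : ℂ)) • B9CubeLettersOpsL0.GpCubeY i c (parSymY i) (gaugeY i u⁻¹ (B9Cor36CubeCutoffs.locCfgY i c η A))).restrictScalars ℝ) *
          mulOp (fun p : SiteY i × ι => B9Cor36CutoffField337.bumpY i (B9Cor36CubeCutoffs.ctrR i c) (3 * (SC i c : ℝ)) p.1) *
          conj b (B9Eq352GradLetters.diffLetter (Node00.shiftY i) (Node00.UboxY i (cfg U₁)) (((etaS i : ℝ) : ℂ))⁻¹ (Sum.inr ν))))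
      (fun a a' => (((M₂ * ∑ j, ‖b j‖) ^ 2 * (BS * Cc) * C4 + κ₂) *
          (M₂ * (∑ j, ‖b j‖) * BG + M₂ * (∑ j, ‖b j‖) * BG * Λ * (B4PartitionUnity22.D1 B4PartitionUnity22.thetaProf / 3)) * Λ * B6.c1 dB δ₀ β') *
        ((geo9K i).len a ^ 3)⁻¹ * Real.exp (-(ρ * δ₀ * (geo9K i).dist a a'))) := by
  have hlen0 : ∀ y : (geo9K i).Site, 0 ≤ (geo9K i).len y := fun y => (geo9K_len_pos i y).le
  -- `T·M_{χ_□}♯`: §2's transfer at `f = χ_□`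
  have hTM := hasMajorant_conj_cubeWord_mul_cut_member i c b (Rr := Rr) (H := H) (Rr' := Rr') (Hp := Hp) hM₂ hrepr u hu ιB hι _ _
    (smul_resolventWordCube_gauge_inv_eq i c σ u (B9Cor36CubeCutoffs.locCfgY i c η A))
    (fun z : SiteY i => B9Cor36CubeCutoffs.chiY i c z) (fun z => (B9Cor36CubeCutoffs.abs_chiY_le_one i c z).1)
    (fun z hz => B9Eq3105FamThreeLocCDiffSplit.nearH_of_nearC_seven_halves i c le_rfl (B9Cor36CubeCutoffs.nearC_of_chiY_ne_zero i c hz))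
    hBS hCc hrc hSTc hSc hST4
  have h := B9Eq3105FamThreeLocCDiffOuterEntries.hasMajorant_mul_rightEntry_at i c b cfg (Rr' := Rr') (Hp := Hp) hE hBG ιB hι hM₂ hrepr hη ν u η A hQ hgA hU hV
    dB hδ₀ haG hα hΛ hT1 hρ hρG h261 (fun a => ((geo9K i).len a ^ 4)⁻¹) (by positivity : 0 ≤ (M₂ * ∑ j, ‖b j‖) ^ 2 * (BS * Cc) * C4) hκ₂
    (fun a => inv_nonneg.2 (pow_nonneg (hlen0 a) _)) hbud hTM hTK
  refine hasMajorant_mono (g := toB6 (geo9K i) Rr' Hp) _ h fun a a' => le_of_eq ?_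
  rw [pow4_inv_mul_self (geo9K_len_pos i a)]

end Gw

end Literature.MathematicalPhysics.QuantumFieldTheory.Balaban1983to89.B9Eq3105FamThreeLocCDiffCubeTails
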